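import Mathlib
import HarnessLib
import Literature.NumberTheory.Irrationality.Zudilin2002.WellPoisedIntegrals

/-!
# ζ(5) search — the nested kernel `Q_k` and a pointwise recursion bound for Zudilin's integrand (cell `pub-zeta5`, ct-1 g27)

HONEST FRAMING: systematic search; no irrationality claim unless kernel-certified.  Elementary real inequalities about the
TYPED objects `Zudilin2002.nestedQ` / `Zudilin2002.sorokinIntegrand` of
`Literature/NumberTheory/Irrationality/Zudilin2002/WellPoisedIntegrals.lean`; nothing here is an irrationality result, a
worthiness exponent or a denominator statement; no named fact is discharged.

Purpose (lineage blueprint `HOME/ct-1/g26/VWP-BLUEPRINT.md`, item "convergence of the typed `J_k`"): the typed right-hand side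
of `Zudilin2002.vwp_eq_integral_of_pos` is a Bochner integral over `[0,1]^k`, junk unless the integrand is integrable.  The
zero set of `Q_k` on the closed cube is `{x₀ = 1} ∩ ({x₁ = 0} ∪ {x₂ = 1} ∩ ({x₃ = 0} ∪ …))`, so integrability is a genuine
condition on the exponents.  This file supplies the pointwise input of an induction on `k` (the sequel file integrates it):

* `nestedQ_ofFn_succ` — `Q_{k+1}(x) = 1 − x₀ · Q_k(x₁, …, x_k)` (the first recursion of Zudilin's (3));
* `nestedQ_mem_Icc`, `nestedQ_mem_Ioo` — `0 ≤ Q ≤ 1` on the closed cube, `0 < Q < 1` on the open cube (Zudilin's (11));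
* `continuous_nestedQ_ofFn`, `measurable_weight` — continuity of `x ↦ Q_k(x)`, measurability of the two-exponent integrand
  `∏ x_j^{a_j−1}(1−x_j)^{b_j−a_j−1} · Q_k^{−a₀} · (1−Q_k)^{−c₀}`;
* `split_rpow_le` — the one-variable kernel bound `((1−t)+tP)^{−a₀} ≤ 2^{a₀}(1−t)^{−max(a₀−γ,0)}P^{−γ}` (`t ∈ (0,1)`,
  `P ∈ (0,1]`, `a₀, γ ≥ 0`);
* `weight_succ_le` — the recursion bound: on the open cube the `(k+1)`-variable two-exponent integrand with exponents `(a₀, c₀)`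
  is at most `2^{a₀} · t^{a₀'−1}(1−t)^{b₀'−1}` (a Beta weight in `t = x₀`) times the `k`-variable integrand in `(x₁,…,x_k)` with
  exponents `(c₀, γ)` — because `Q_{k+1} = (1−x₀) + x₀(1−Q_k)` and `1 − Q_{k+1} = x₀ Q_k`.

Theorems only (no definitions); imports the typed Literature file and Mathlib.
-/

noncomputable section

namespace Summit.KontsevichZagierPeriods.Zeta5Search.SorokinIntegrandBounds

open MeasureTheory Set Filter
open Literature.NumberTheory.Irrationality.Zudilin2002 (nestedQ sorokinIntegrand)

/-! ### 1. The nested kernel -/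

/-- First recursion of Zudilin's (3) on `Fin (k+1) → ℝ`: `Q_{k+1}(x) = 1 − x₀ · Q_k(x ∘ succ)`. -/
theorem nestedQ_ofFn_succ {k : ℕ} (x : Fin (k + 1) → ℝ) :
    nestedQ (List.ofFn x) = 1 - x 0 * nestedQ (List.ofFn fun j : Fin k => x j.succ) := by
  rw [List.ofFn_succ]
  rfl

/-- The same recursion for `Fin.cons`: `Q_{k+1}(t, x') = 1 − t · Q_k(x')`. -/
theorem nestedQ_ofFn_cons {k : ℕ} (t : ℝ) (x' : Fin k → ℝ) :
    nestedQ (List.ofFn (Fin.cons t x' : Fin (k + 1) → ℝ)) = 1 - t * nestedQ (List.ofFn x') := by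
  rw [nestedQ_ofFn_succ]
  simp only [Fin.cons_zero, Fin.cons_succ]

/-- On lists with entries in `[0,1]`, `0 ≤ Q ≤ 1`. -/
theorem nestedQ_mem_Icc : ∀ (l : List ℝ), (∀ t ∈ l, t ∈ Icc (0 : ℝ) 1) → nestedQ l ∈ Icc (0 : ℝ) 1
  | [], _ => by simp [nestedQ]
  | t :: l, h => by
    have ht : t ∈ Icc (0 : ℝ) 1 := h t (by simp)
    have hl := nestedQ_mem_Icc l fun s hs => h s (by simp [hs])
    simp only [nestedQ, mem_Icc] at hl ⊢
    constructor <;> nlinarith [ht.1, ht.2, hl.1, hl.2, mul_nonneg ht.1 hl.1]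

/-- On nonempty lists with entries in `(0,1)`, `0 < Q < 1` (Zudilin's (11)). -/
theorem nestedQ_mem_Ioo : ∀ (l : List ℝ), l ≠ [] → (∀ t ∈ l, t ∈ Ioo (0 : ℝ) 1) → nestedQ l ∈ Ioo (0 : ℝ) 1
  | [], h, _ => (h rfl).elim
  | t :: l, _, h => by
    have ht : t ∈ Ioo (0 : ℝ) 1 := h t (by simp)
    have hl : nestedQ l ∈ Icc (0 : ℝ) 1 := nestedQ_mem_Icc l fun s hs => Ioo_subset_Icc_self (h s (by simp [hs]))
    rcases l with _ | ⟨s, l'⟩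
    · simp only [nestedQ, mem_Ioo, mul_one]
      constructor <;> linarith [ht.1, ht.2]
    · have hl' : nestedQ (s :: l') ∈ Ioo (0 : ℝ) 1 := nestedQ_mem_Ioo (s :: l') (by simp) fun r hr => h r (by simp [hr])
      simp only [mem_Ioo] at hl' ⊢
      change 0 < 1 - t * nestedQ (s :: l') ∧ 1 - t * nestedQ (s :: l') < 1
      constructor <;> nlinarith [ht.1, ht.2, hl'.1, hl'.2, mul_pos ht.1 hl'.1, mul_lt_mul'' ht.2 hl'.2 ht.1.le hl'.1.le]

/-- On the open cube (`k ≥ 1`), `0 < Q_k(x) < 1`. -/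
theorem nestedQ_ofFn_mem_Ioo {k : ℕ} (hk : 1 ≤ k) {x : Fin k → ℝ} (hx : ∀ j, x j ∈ Ioo (0 : ℝ) 1) :
    nestedQ (List.ofFn x) ∈ Ioo (0 : ℝ) 1 := by
  refine nestedQ_mem_Ioo _ ?_ fun t ht => ?_
  · intro h
    have := congrArg List.length h
    simp at this
    omega
  · obtain ⟨j, rfl⟩ := (List.mem_ofFn' _ _).1 ht
    exact hx j

/-- On the closed cube, `0 ≤ Q_k(x) ≤ 1`. -/
theorem nestedQ_ofFn_mem_Icc {k : ℕ} {x : Fin k → ℝ} (hx : ∀ j, x j ∈ Icc (0 : ℝ) 1) :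
    nestedQ (List.ofFn x) ∈ Icc (0 : ℝ) 1 :=
  nestedQ_mem_Icc _ fun t ht => by
    obtain ⟨j, rfl⟩ := (List.mem_ofFn' _ _).1 ht
    exact hx j

/-- Continuity of `x ↦ Q_k(x)` on `Fin k → ℝ` (a polynomial in the coordinates). -/
theorem continuous_nestedQ_ofFn : ∀ k : ℕ, Continuous fun x : Fin k → ℝ => nestedQ (List.ofFn x)
  | 0 => by simp [nestedQ]; exact continuous_const
  | k + 1 => by
    have ih := continuous_nestedQ_ofFn k
    have h : (fun x : Fin (k + 1) → ℝ => nestedQ (List.ofFn x)) =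
        fun x => 1 - x 0 * nestedQ (List.ofFn fun j : Fin k => x j.succ) := by
      funext x; exact nestedQ_ofFn_succ x
    rw [h]
    exact continuous_const.sub ((continuous_apply 0).mul (ih.comp (continuous_pi fun j => continuous_apply _)))

/-- Measurability of the two-exponent integrand `∏ x_j^{a_j−1}(1−x_j)^{b_j−a_j−1} · Q_k^{−a₀} · (1−Q_k)^{−c₀}`. -/
theorem measurable_weight (k : ℕ) (a₀ c₀ : ℝ) (a b : ℕ → ℝ) :
    Measurable fun x : Fin k → ℝ =>
      (∏ j : Fin k, x j ^ (a j - 1) * (1 - x j) ^ (b j - a j - 1)) *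
        nestedQ (List.ofFn x) ^ (-a₀) * (1 - nestedQ (List.ofFn x)) ^ (-c₀) := by
  have hQ := (continuous_nestedQ_ofFn k).measurable
  refine Measurable.mul (Measurable.mul ?_ (hQ.pow_const _)) ((measurable_const.sub hQ).pow_const _)
  refine Finset.measurable_prod _ fun j _ => ?_
  exact ((measurable_pi_apply j).pow_const _).mul ((measurable_const.sub (measurable_pi_apply j)).pow_const _)

/-- On the closed cube the typed integrand is the two-exponent integrand with `c₀ = 0`. -/
theorem sorokinIntegrand_eq (k : ℕ) (a₀ : ℝ) (a b : ℕ → ℝ) {x : Fin k → ℝ} (hx : ∀ j, x j ∈ Icc (0 : ℝ) 1) :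
    sorokinIntegrand k a₀ a b x =
      (∏ j : Fin k, x j ^ (a j - 1) * (1 - x j) ^ (b j - a j - 1)) *
        nestedQ (List.ofFn x) ^ (-a₀) * (1 - nestedQ (List.ofFn x)) ^ (-(0 : ℝ)) := by
  rw [sorokinIntegrand, neg_zero, Real.rpow_zero, mul_one, div_eq_mul_inv, Real.rpow_neg (nestedQ_ofFn_mem_Icc hx).1]

/-! ### 2. The one-variable kernel bound -/

/-- `(1/2)^{−a} = 2^{a}`. -/
theorem half_rpow_neg (a : ℝ) : (1 / 2 : ℝ) ^ (-a) = 2 ^ a := by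
  rw [one_div, Real.inv_rpow (by norm_num), Real.rpow_neg (by norm_num), inv_inv]

/-- **The splitting bound**: for `t ∈ (0,1)`, `P ∈ (0,1]`, `a₀ ≥ 0`, `γ ≥ 0`,
`((1−t) + tP)^{−a₀} ≤ 2^{a₀} (1−t)^{−max(a₀−γ,0)} P^{−γ}` — on `t ≤ 1/2` the base is `≥ 1/2`; on `t ≥ 1/2` it is
`≥ (max(1−t, P))/2` and `max^{−a₀} = max^{−δ}·max^{−(a₀−δ)} ≤ (1−t)^{−δ} P^{−γ}` (`δ = max(a₀−γ,0)`, `P ≤ 1`). -/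
theorem split_rpow_le {t P a₀ γ : ℝ} (ht : t ∈ Ioo (0 : ℝ) 1) (hP : P ∈ Ioc (0 : ℝ) 1) (ha₀ : 0 ≤ a₀) (hγ : 0 ≤ γ) :
    ((1 - t) + t * P) ^ (-a₀) ≤ (2 : ℝ) ^ a₀ * (1 - t) ^ (-max (a₀ - γ) 0) * P ^ (-γ) := by
  have hu : 0 < 1 - t := by linarith [ht.2]
  have hu1 : 1 - t ≤ 1 := by linarith [ht.1]
  set δ : ℝ := max (a₀ - γ) 0 with hδ
  have hδ0 : 0 ≤ δ := le_max_right _ _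
  have hδa : δ ≤ a₀ := max_le (by linarith) ha₀
  have hγ' : a₀ - δ ≤ γ := by have := le_max_left (a₀ - γ) 0; rw [← hδ] at this; linarith
  have hm : 0 < (1 - t) + t * P := by nlinarith [ht.1, hP.1]
  -- the right-hand side dominates `2^{a₀}`
  have h1 : 1 ≤ (1 - t) ^ (-δ) := Real.one_le_rpow_of_pos_of_le_one_of_nonpos hu hu1 (by linarith)
  have h2 : 1 ≤ P ^ (-γ) := Real.one_le_rpow_of_pos_of_le_one_of_nonpos hP.1 hP.2 (by linarith)
  have h2a : (0 : ℝ) < 2 ^ a₀ := by positivity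
  rcases le_or_gt t (1 / 2) with hth | hth
  · -- `t ≤ 1/2`: the base is at least `1/2`
    have hbase : (1 / 2 : ℝ) ≤ (1 - t) + t * P := by nlinarith [ht.1, hP.1]
    calc ((1 - t) + t * P) ^ (-a₀) ≤ (1 / 2 : ℝ) ^ (-a₀) := Real.rpow_le_rpow_of_nonpos (by norm_num) hbase (by linarith)
      _ = 2 ^ a₀ * 1 * 1 := by rw [half_rpow_neg, mul_one, mul_one]
      _ ≤ 2 ^ a₀ * (1 - t) ^ (-δ) * P ^ (-γ) := by gcongr
  · -- `t > 1/2`: the base is at least `max(1−t, P)/2`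
    set M : ℝ := max (1 - t) P with hM
    have hM0 : 0 < M := lt_max_of_lt_left hu
    have hbase : M / 2 ≤ (1 - t) + t * P := by
      have : M ≤ (1 - t) + P := max_le (by linarith [hP.1]) (by linarith)
      nlinarith [hP.1]
    have hMa : M ^ (-a₀) = M ^ (-δ) * M ^ (-(a₀ - δ)) := by
      rw [← Real.rpow_add hM0]; congr 1; ring
    have hMu : M ^ (-δ) ≤ (1 - t) ^ (-δ) := Real.rpow_le_rpow_of_nonpos hu (le_max_left _ _) (by linarith)
    have hMP : M ^ (-(a₀ - δ)) ≤ P ^ (-γ) :=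
      calc M ^ (-(a₀ - δ)) ≤ P ^ (-(a₀ - δ)) := Real.rpow_le_rpow_of_nonpos hP.1 (le_max_right _ _) (by linarith)
        _ ≤ P ^ (-γ) := Real.rpow_le_rpow_of_exponent_ge hP.1 hP.2 (by linarith)
    calc ((1 - t) + t * P) ^ (-a₀) ≤ (M / 2) ^ (-a₀) := Real.rpow_le_rpow_of_nonpos (by positivity) hbase (by linarith)
      _ = 2 ^ a₀ * (M ^ (-δ) * M ^ (-(a₀ - δ))) := by
          rw [Real.div_rpow hM0.le (by norm_num), Real.rpow_neg (by norm_num : (0 : ℝ) ≤ 2), hMa]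
          field_simp
      _ ≤ 2 ^ a₀ * ((1 - t) ^ (-δ) * P ^ (-γ)) := by gcongr
      _ = 2 ^ a₀ * (1 - t) ^ (-δ) * P ^ (-γ) := by ring

/-! ### 3. The recursion bound for the two-exponent integrand -/

/-- **Recursion bound** (`k ≥ 1`, open cube): for `x = Fin.cons t x'`, with `Q_{k+1}(x) = (1−t) + t(1−Q_k(x'))`,
`1 − Q_{k+1}(x) = t·Q_k(x')` and `split_rpow_le`, the `(k+1)`-variable integrand with exponents `(a₀, c₀)` is at most
`2^{a₀} · t^{a₀−c₀−1}(1−t)^{b₀−a₀−max(a₀−γ,0)−1}` times the `k`-variable integrand in `x'` with exponents `(c₀, γ)` and shifted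
parameters `a(·+1)`, `b(·+1)` (`a₀, γ ≥ 0`). -/
theorem weight_succ_le {k : ℕ} (hk : 1 ≤ k) {a₀ γ : ℝ} (ha₀ : 0 ≤ a₀) (hγ : 0 ≤ γ) (c₀ : ℝ) (a b : ℕ → ℝ)
    {t : ℝ} {x' : Fin k → ℝ} (ht : t ∈ Ioo (0 : ℝ) 1) (hx' : ∀ j, x' j ∈ Ioo (0 : ℝ) 1) :
    (∏ j : Fin (k + 1), (Fin.cons t x' : Fin (k + 1) → ℝ) j ^ (a j - 1) *
          (1 - (Fin.cons t x' : Fin (k + 1) → ℝ) j) ^ (b j - a j - 1)) *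
        nestedQ (List.ofFn (Fin.cons t x' : Fin (k + 1) → ℝ)) ^ (-a₀) *
          (1 - nestedQ (List.ofFn (Fin.cons t x' : Fin (k + 1) → ℝ))) ^ (-c₀) ≤
      (2 : ℝ) ^ a₀ * (t ^ (a 0 - c₀ - 1) * (1 - t) ^ (b 0 - a 0 - max (a₀ - γ) 0 - 1)) *
        ((∏ j : Fin k, x' j ^ (a ((j : ℕ) + 1) - 1) * (1 - x' j) ^ (b ((j : ℕ) + 1) - a ((j : ℕ) + 1) - 1)) *
          nestedQ (List.ofFn x') ^ (-c₀) * (1 - nestedQ (List.ofFn x')) ^ (-γ)) := by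
  have hu : 0 < 1 - t := by linarith [ht.2]
  have hq : nestedQ (List.ofFn x') ∈ Ioo (0 : ℝ) 1 := nestedQ_ofFn_mem_Ioo hk hx'
  have hP : 1 - nestedQ (List.ofFn x') ∈ Ioc (0 : ℝ) 1 := ⟨by linarith [hq.2], by linarith [hq.1]⟩
  have hQ : nestedQ (List.ofFn (Fin.cons t x' : Fin (k + 1) → ℝ)) = (1 - t) + t * (1 - nestedQ (List.ofFn x')) := by
    rw [nestedQ_ofFn_cons]; ring
  have h1Q : 1 - nestedQ (List.ofFn (Fin.cons t x' : Fin (k + 1) → ℝ)) = t * nestedQ (List.ofFn x') := by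
    rw [nestedQ_ofFn_cons]; ring
  -- split the product over `Fin (k+1)`
  have hprod : (∏ j : Fin (k + 1), (Fin.cons t x' : Fin (k + 1) → ℝ) j ^ (a j - 1) *
        (1 - (Fin.cons t x' : Fin (k + 1) → ℝ) j) ^ (b j - a j - 1)) =
      (t ^ (a 0 - 1) * (1 - t) ^ (b 0 - a 0 - 1)) *
        ∏ j : Fin k, x' j ^ (a ((j : ℕ) + 1) - 1) * (1 - x' j) ^ (b ((j : ℕ) + 1) - a ((j : ℕ) + 1) - 1) := by
    rw [Fin.prod_univ_succ]
    simp only [Fin.cons_zero, Fin.cons_succ, Fin.val_zero, Fin.val_succ]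
  have hR0 : 0 ≤ ∏ j : Fin k, x' j ^ (a ((j : ℕ) + 1) - 1) * (1 - x' j) ^ (b ((j : ℕ) + 1) - a ((j : ℕ) + 1) - 1) :=
    Finset.prod_nonneg fun j _ =>
      mul_nonneg (Real.rpow_nonneg (hx' j).1.le _) (Real.rpow_nonneg (by linarith [(hx' j).2]) _)
  have hf0 : 0 ≤ t ^ (a 0 - 1) * (1 - t) ^ (b 0 - a 0 - 1) := mul_nonneg (Real.rpow_nonneg ht.1.le _) (Real.rpow_nonneg hu.le _)
  have hsplit := split_rpow_le ht hP ha₀ hγ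
  have hmul : (t * nestedQ (List.ofFn x')) ^ (-c₀) = t ^ (-c₀) * nestedQ (List.ofFn x') ^ (-c₀) :=
    Real.mul_rpow ht.1.le hq.1.le
  have htq0 : 0 ≤ (t * nestedQ (List.ofFn x')) ^ (-c₀) := Real.rpow_nonneg (mul_nonneg ht.1.le hq.1.le) _
  rw [hprod, h1Q, hQ]
  calc t ^ (a 0 - 1) * (1 - t) ^ (b 0 - a 0 - 1) *
          (∏ j : Fin k, x' j ^ (a ((j : ℕ) + 1) - 1) * (1 - x' j) ^ (b ((j : ℕ) + 1) - a ((j : ℕ) + 1) - 1)) *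
          ((1 - t) + t * (1 - nestedQ (List.ofFn x'))) ^ (-a₀) * (t * nestedQ (List.ofFn x')) ^ (-c₀)
      ≤ t ^ (a 0 - 1) * (1 - t) ^ (b 0 - a 0 - 1) *
          (∏ j : Fin k, x' j ^ (a ((j : ℕ) + 1) - 1) * (1 - x' j) ^ (b ((j : ℕ) + 1) - a ((j : ℕ) + 1) - 1)) *
          ((2 : ℝ) ^ a₀ * (1 - t) ^ (-max (a₀ - γ) 0) * (1 - nestedQ (List.ofFn x')) ^ (-γ)) *
          (t * nestedQ (List.ofFn x')) ^ (-c₀) :=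
        mul_le_mul_of_nonneg_right (mul_le_mul_of_nonneg_left hsplit (mul_nonneg hf0 hR0)) htq0
    _ = (2 : ℝ) ^ a₀ * ((t ^ (a 0 - 1) * t ^ (-c₀)) * ((1 - t) ^ (b 0 - a 0 - 1) * (1 - t) ^ (-max (a₀ - γ) 0))) *
          ((∏ j : Fin k, x' j ^ (a ((j : ℕ) + 1) - 1) * (1 - x' j) ^ (b ((j : ℕ) + 1) - a ((j : ℕ) + 1) - 1)) *
            nestedQ (List.ofFn x') ^ (-c₀) * (1 - nestedQ (List.ofFn x')) ^ (-γ)) := by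
        rw [hmul]; ring
    _ = _ := by
        rw [← Real.rpow_add ht.1, ← Real.rpow_add hu]
        congr 3 <;> ring

end Summit.KontsevichZagierPeriods.Zeta5Search.SorokinIntegrandBounds

end
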